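import Summits.Langlands.Langlands.Statement
import Literature.NumberTheory.Automorphic.GelbartJacquetSymmSquare
import Literature.NumberTheory.Automorphic.Sweep1SymmetricPower
import HarnessLib

/-!
# Line `SymmFifthGaloisToAutomorphic` — ON-PATH FILE (forward generator G4 ladder-down, generation 7)
# top crux `IrreducibilityBySelfDuality.ReciprocityUpToIrreducibility` (stmt-Langlands-14328)

`Langlands → SymmPowerGaloisToAutomorphic m` for every `m` (restriction of clause (B) at rank `m + 1` to the
`Rec` the summit provides: the family's de Rham clause is against `fontainePstAdicCompletion = Rec.pst` by `rfl`,
a.e. unramifiedness is read off the Satake-match hypothesis, cuspidal ⇒ automorphic, `Corresponds` ⊃ a.e. Satake),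
and the `@[aesop safe apply]` instance `SymmFifthGaloisToAutomorphic_of_Langlands` used by the kernel's on-path test.
No `sorry`.
-/

noncomputable section

set_option linter.dupNamespace false

open scoped MatrixGroups Matrix NumberField Classical Polynomial
open Filter IsDedekindDomain Field Polynomial
open Literature.NumberTheory.Automorphic Literature.NumberTheory.GaloisRepresentations
open Literature.NumberTheory.PAdicHodge
open Summit.Langlands

namespace Summit.Langlands.Langlands.Cruxes.ReciprocityUpToIrreducibility.SymmFifthGaloisToAutomorphic

/-! ## 2. The graded family (dial = symmetric-power degree `m`, rank `m + 1`) and the rung `m = 5` -/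

/-- **The rung family** `SymmPowerGaloisToAutomorphic m`: clause (B) of the summit (Galois ⇒ automorphic) over
EVERY number field `F`, at EVERY `ℓ` and `ι : ℚ̄_ℓ ≃ ℂ`, in the a.e.-Satake form, for irreducible
`ρ : Γ_F → GL_{m+1}(ℚ̄_ℓ)` de Rham above `ℓ` (pinned Fontaine datum `fontainePstAdicCompletion`) whose Frobenius
characteristic polynomials are, at all but finitely many places, the `ι`-Satake polynomials of `Symᵐ{a_v, b_v}`
for the Satake pairs `{a_v, b_v}` of a CUSPIDAL `π` on `GL₂(𝔸_F)` — the unramified shadow of "`ρ ≅ Symᵐ ρ_π`".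
Conclusion: an AUTOMORPHIC `P` on `GL_{m+1}(𝔸_F)` (Borel–Jacquet datum, not asserted cuspidal) with
`SatakeFrobCompatibleAt ι P ρ v` for almost all `v`.  Monotone in the summit direction
(`symmPowerGaloisToAutomorphic_of_langlands`); implied by weak `Symᵐ` functoriality
(`of_weakSymmPowerFunctoriality`), hence PROVED at `m = 2` (Gelbart–Jacquet, in tree) and known in print at
`m = 3, 4` (Kim–Shahidi, Kim); OPEN at `m = 5` off the totally-real regular-algebraic sector (Newton–Thorne). -/
def SymmPowerGaloisToAutomorphic (m : ℕ) : Prop :=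
  ∀ (F : Type) [Field F] [NumberField F]
    (h2 : Literature.NumberTheory.Automorphic.isCompact_glFiniteIntegralLevel 2 F)
    (π : Literature.NumberTheory.Automorphic.CuspidalAutomorphicRepData 2 F h2)
    (ℓ : ℕ) [Fact ℓ.Prime] (ι : PadicAlgCl ℓ ≃+* ℂ)
    (ρ : Literature.NumberTheory.GaloisRepresentations.FramedGaloisRep F (PadicAlgCl ℓ) (m + 1)),
    ρ.toGaloisRep.IsIrreducible →
    (∀ (v : IsDedekindDomain.HeightOneSpectrum (NumberField.RingOfIntegers F))
      (hv : ((ℓ : ℕ) : NumberField.RingOfIntegers F) ∈ v.asIdeal),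
      (Literature.NumberTheory.PAdicHodge.fontainePstAdicCompletion v ℓ hv).IsDeRhamFramed (ρ.toLocal v)) →
    (∀ᶠ v : IsDedekindDomain.HeightOneSpectrum (NumberField.RingOfIntegers F) in Filter.cofinite,
      ∃ a b : ℂ, π.1.HasSatakeParamAt v {a, b} ∧ ρ.IsUnramifiedAt v ∧
        ρ.HasFrobCharpolyAt v
          (Literature.NumberTheory.Automorphic.arithFrobPolyOfSatake ι v.residueCard 1
            (Literature.NumberTheory.Automorphic.symmPowerParams m a b))) →
    ∀ hcpt : Literature.NumberTheory.Automorphic.isCompact_glFiniteIntegralLevel (m + 1) F,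
      ∃ P : Literature.NumberTheory.Automorphic.AutomorphicRepData
          (Literature.NumberTheory.Automorphic.AutomorphyDatum.gl (m + 1) F hcpt),
        ∀ᶠ v : IsDedekindDomain.HeightOneSpectrum (NumberField.RingOfIntegers F) in Filter.cofinite,
          Summit.Langlands.SatakeFrobCompatibleAt ι P ρ v

/-- **THE RUNG** (the filed statement): the family at `m = 5` — clause (B) for `GL₆`-representations of
symmetric-fifth type over every number field. -/
def SymmFifthGaloisToAutomorphic : Prop := SymmPowerGaloisToAutomorphic 5

/-! ## 5. On-path: the summit gives every rung -/

/-- **Dial monotonicity in the summit direction**: `Langlands → SymmPowerGaloisToAutomorphic m` for every `m`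
— clause (B) at rank `m + 1` over `F` for the reciprocity datum the summit provides; the sector's de Rham
clause is against `Rec.pst` by `rfl`, a.e.-unramifiedness is part of the sector clause, a cuspidal datum is
in particular automorphic and `Corresponds` contains the a.e. Satake clause. -/
theorem symmPowerGaloisToAutomorphic_of_langlands (m : ℕ) (hL : _root_.Langlands) :
    SymmPowerGaloisToAutomorphic m := by
  intro F _ _ h2 π ℓ _ ι ρ hirr hdR hsym hcpt
  obtain ⟨⟨Rec⟩, hall⟩ := hL F
  have hB : GaloisToAutomorphic (m + 1) Rec hcpt := (hall Rec (m + 1) (Nat.succ_pos m) hcpt).2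
  have hgeo : IsGeometricFramed Rec ρ :=
    ⟨hsym.mono fun v ⟨_, _, _, hur, _⟩ => hur, fun v hv => hdR v hv⟩
  obtain ⟨π', -, hcorr⟩ := hB ℓ ι ρ hirr hgeo
  exact ⟨π'.1, hcorr.1⟩

/-- **F4 on-path lemma for the rung**: `Langlands → SymmFifthGaloisToAutomorphic`. -/
@[aesop safe apply]
theorem SymmFifthGaloisToAutomorphic_of_Langlands (hL : _root_.Langlands) : SymmFifthGaloisToAutomorphic :=
  symmPowerGaloisToAutomorphic_of_langlands 5 hL

end Summit.Langlands.Langlands.Cruxes.ReciprocityUpToIrreducibility.SymmFifthGaloisToAutomorphic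

end
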